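import Mathlib.NumberTheory.NumberField.CMField
import HarnessLib

/-!
# A CM field is `L⁺(√θ)` with `θ` a totally negative algebraic integer of `L⁺`

Topic `NumberTheory/NumberFields`; namespace `Literature.NumberTheory.NumberFields`. Theorems only (no
definition, no named fact, no instance); Mathlib only.

Let `L` be a CM field (Mathlib `NumberField.IsCMField L`: a totally complex quadratic extension of its maximal
real subfield `L⁺ = maximalRealSubfield L`) with complex conjugation `σ = IsCMField.complexConj L`.

* `re_embedding_eq_zero_of_complexConj_eq_neg` — if `σ α = -α` then `φ(α)` is purely imaginary for every
  `φ : L →+* ℂ` (`φ ∘ σ = conj ∘ φ`, Mathlib `IsCMField.complexEmbedding_complexConj`);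
* `sq_mem_maximalRealSubfield_of_complexConj_eq_neg`, `not_mem_maximalRealSubfield_of_complexConj_eq_neg` —
  `α² ∈ L⁺` and, if `α ≠ 0`, `α ∉ L⁺`; conversely `complexConj_eq_neg_of_sq_mem` — `β² ∈ L⁺`, `β ∉ L⁺` force
  `σ β = -β`;
* `embedding_sq_lt_zero_of_complexConj_eq_neg` — for `α ≠ 0` with `σ α = -α`, `v(α²) < 0` at every (real)
  place `v` of `L⁺` (`v(α²) = φ(α)²` for a `φ` above `v`, and `φ(α) ∈ iℝ ∖ {0}`);
* **`IsCMField.exists_ringOfIntegers_totallyNegative_sqrt`** — there are `θ ∈ 𝓞 L⁺` and `α ∈ L` with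
  `α ≠ 0`, `σ α = -α`, `α² = θ`, `θ` not a square in `L⁺`, and `v(θ) < 0` at every real place `v` of `L⁺`
  (take `α₀ = x - σ x` for any `x ∉ L⁺` and clear the denominator of `α₀²` by a square); so `L = L⁺(α)`,
  `α² = θ` totally negative — the normal form "`K = F(√-Δ)`, `Δ ∈ F` totally positive" of a CM field
  (Shimura, *Abelian varieties with complex multiplication and modular functions* (1998), §18.2 (1); Milne,
  *Complex Multiplication* (2006), §1.1–1.4);
* `exists_eq_algebraMap_mul_of_complexConj_eq_neg`, `exists_mul_sq_eq_of_sq_eq` — two such square roots differ by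
  a factor from `L⁺`, so two presentations `L = L⁺(√θ) = L⁺(√θ')` have `θ' = θ r²`, `r ∈ L⁺` (the square
  class of `θ` in `L⁺` is an invariant of `L/L⁺`).

These feed the quadratic Hecke character `ε_{L/L⁺}` of the CM extension
(`Literature/NumberTheory/Automorphic/QuadraticHeckeCharacterCM.lean`: the tree's `quadraticHeckeChar L⁺ θ`
needs `θ ∈ 𝓞 L⁺`, and its archimedean type `sgn` needs `θ` totally negative).

Provenance: tree-vocabulary form of the `pub-hodgecm` package theorem
`NumberField.IsCMField.exists_totallyNegative_generator` (`HodgeCM/Literature/QuadraticCharacterCM.lean`,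
CITED-FACT seat gen 6), with the generator moved into `𝓞 L⁺` and the uniqueness-up-to-squares clause added.

## References

* G. Shimura, *Abelian Varieties with Complex Multiplication and Modular Functions*, Princeton Univ. Press
  (1998), §18.2. [folklore]
* J. S. Milne, *Complex Multiplication* (course notes, 2006), §1, Prop. 1.4. [folklore]
-/

noncomputable section

open NumberField NumberField.InfinitePlace
open scoped ComplexConjugate

namespace Literature.NumberTheory.NumberFields

variable (L : Type) [Field L] [NumberField L] [IsCMField L]

/-! ## Purely imaginary elements -/

/-- Some element of a CM field is moved by complex conjugation (`σ ≠ 1`). [folklore] -/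
theorem IsCMField.exists_complexConj_ne : ∃ x : L, IsCMField.complexConj L x ≠ x := by
  by_contra! h
  exact IsCMField.complexConj_ne_one L (AlgEquiv.ext h)

variable {L}

/-- If `σ α = -α` then `φ(α)` is purely imaginary for every complex embedding `φ`. [folklore] -/
theorem re_embedding_eq_zero_of_complexConj_eq_neg (φ : L →+* ℂ) {α : L}
    (hα : IsCMField.complexConj L α = -α) : (φ α).re = 0 := by
  have h : conj (φ α) = -φ α := by
    rw [← IsCMField.complexEmbedding_complexConj, hα, map_neg]
  have h' := congrArg Complex.re h
  rw [Complex.conj_re, Complex.neg_re] at h'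
  linarith

/-- If `σ α = -α` then `α² ∈ L⁺`. [folklore] -/
theorem sq_mem_maximalRealSubfield_of_complexConj_eq_neg {α : L} (hα : IsCMField.complexConj L α = -α) :
    α ^ 2 ∈ maximalRealSubfield L := by
  rw [← IsCMField.complexConj_eq_self_iff, map_pow, hα, neg_sq]

/-- If `σ α = -α` and `α ≠ 0` then `α ∉ L⁺`. [folklore] -/
theorem not_mem_maximalRealSubfield_of_complexConj_eq_neg {α : L} (hα : IsCMField.complexConj L α = -α)
    (hα0 : α ≠ 0) : α ∉ maximalRealSubfield L := by
  intro hmem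
  have hfix : IsCMField.complexConj L α = α := (IsCMField.complexConj_eq_self_iff L α).2 hmem
  rw [hα, neg_eq_iff_add_eq_zero, ← two_mul, mul_eq_zero] at hfix
  exact hfix.elim two_ne_zero hα0

/-- If `σ α = -α` and `α ≠ 0` then `α` is not (the image of) an element of `L⁺`. [folklore] -/
theorem algebraMap_ne_of_complexConj_eq_neg {α : L} (hα : IsCMField.complexConj L α = -α) (hα0 : α ≠ 0)
    (r : maximalRealSubfield L) : algebraMap (maximalRealSubfield L) L r ≠ α := by
  intro h
  exact not_mem_maximalRealSubfield_of_complexConj_eq_neg hα hα0 (h ▸ r.2)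

/-- Conversely: if `β² ∈ L⁺` and `β ∉ L⁺` then `σ β = -β` (`(σ β)² = β²` and `σ β ≠ β`). [folklore] -/
theorem complexConj_eq_neg_of_sq_mem {β : L} (hβ2 : β ^ 2 ∈ maximalRealSubfield L)
    (hβ : β ∉ maximalRealSubfield L) : IsCMField.complexConj L β = -β := by
  have hsq : (IsCMField.complexConj L β) ^ 2 = β ^ 2 := by
    rw [← map_pow]
    exact (IsCMField.complexConj_eq_self_iff L _).2 hβ2
  rcases sq_eq_sq_iff_eq_or_eq_neg.1 hsq with h | h
  · exact absurd ((IsCMField.complexConj_eq_self_iff L β).1 h) hβ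
  · exact h

/-- **`α²` is totally negative**: for `α ≠ 0` with `σ α = -α` and every real place `v` of `L⁺`,
`v(α²) < 0` (`v(α²) = φ(α)²` for an embedding `φ` of `L` above `v`, and `φ(α) ∈ iℝ ∖ {0}`). [folklore] -/
theorem embedding_sq_lt_zero_of_complexConj_eq_neg {α : L} (hα : IsCMField.complexConj L α = -α)
    (hα0 : α ≠ 0) (v : InfinitePlace (maximalRealSubfield L)) (hv : v.IsReal) :
    embedding_of_isReal hv ⟨α ^ 2, sq_mem_maximalRealSubfield_of_complexConj_eq_neg hα⟩ < 0 := by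
  obtain ⟨w, hw⟩ := comap_surjective (K := L) (k := maximalRealSubfield L) v
  have hemb : (v.embedding : maximalRealSubfield L →+* ℂ) =
      w.embedding.comp (algebraMap (maximalRealSubfield L) L) := by
    subst hw
    exact comap_embedding_of_isReal _ hv
  set z : ℂ := w.embedding α with hz
  have hre : z.re = 0 := re_embedding_eq_zero_of_complexConj_eq_neg w.embedding hα
  have hz0 : z ≠ 0 := by
    rw [hz]
    exact (map_ne_zero_iff _ w.embedding.injective).2 hα0
  have him : z.im ≠ 0 := fun h => hz0 (Complex.ext hre h)
  have hval : ((embedding_of_isReal hv ⟨α ^ 2, sq_mem_maximalRealSubfield_of_complexConj_eq_neg hα⟩ : ℝ) : ℂ)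
      = z ^ 2 := by
    rw [embedding_of_isReal_apply, hemb, RingHom.comp_apply, hz, ← map_pow]
    rfl
  have hre2 : (z ^ 2).re = -(z.im ^ 2) := by
    rw [sq, Complex.mul_re, hre]; ring
  have h : embedding_of_isReal hv ⟨α ^ 2, sq_mem_maximalRealSubfield_of_complexConj_eq_neg hα⟩ = (z ^ 2).re := by
    rw [← hval, Complex.ofReal_re]
  rw [h, hre2, neg_lt_zero]
  positivity

/-- The same for an element `θ ∈ L⁺` given as `α² = θ` in `L`. [folklore] -/
theorem embedding_lt_zero_of_sq_eq {α : L} (hα : IsCMField.complexConj L α = -α) (hα0 : α ≠ 0)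
    {θ : maximalRealSubfield L} (h : α ^ 2 = algebraMap (maximalRealSubfield L) L θ)
    (v : InfinitePlace (maximalRealSubfield L)) (hv : v.IsReal) : embedding_of_isReal hv θ < 0 := by
  have hθ : θ = ⟨α ^ 2, sq_mem_maximalRealSubfield_of_complexConj_eq_neg hα⟩ := Subtype.ext h.symm
  rw [hθ]
  exact embedding_sq_lt_zero_of_complexConj_eq_neg hα hα0 v hv

/-- `θ` with a purely imaginary non-zero square root in `L` is not a square in `L⁺`. [folklore] -/
theorem not_isSquare_of_sq_eq {α : L} (hα : IsCMField.complexConj L α = -α) (hα0 : α ≠ 0)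
    {θ : maximalRealSubfield L} (h : α ^ 2 = algebraMap (maximalRealSubfield L) L θ) : ¬ IsSquare θ := by
  rintro ⟨b, hb⟩
  have hsq : α ^ 2 = (algebraMap (maximalRealSubfield L) L b) ^ 2 := by rw [h, hb, map_mul, sq]
  rcases sq_eq_sq_iff_eq_or_eq_neg.1 hsq with h1 | h1
  · exact algebraMap_ne_of_complexConj_eq_neg hα hα0 b h1.symm
  · exact algebraMap_ne_of_complexConj_eq_neg hα hα0 (-b) (by rw [map_neg, h1])

variable (L)

/-! ## The normal form `L = L⁺(√θ)`, `θ ∈ 𝓞 L⁺` totally negative -/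

/-- **A CM field is `L⁺(√θ)` with `θ ∈ 𝓞 L⁺` totally negative.** There are an algebraic integer `θ` of
`L⁺` and `α ∈ L` with `α ≠ 0`, `σ α = -α` (so `α ∉ L⁺` and `L = L⁺(α)`), `α² = θ`, `θ` not a square in `L⁺`,
and `v(θ) < 0` at every real place `v` of `L⁺`. [folklore] -/
theorem IsCMField.exists_ringOfIntegers_totallyNegative_sqrt :
    ∃ (θ : 𝓞 (maximalRealSubfield L)) (α : L), α ≠ 0 ∧ IsCMField.complexConj L α = -α ∧
      α ^ 2 = algebraMap (maximalRealSubfield L) L θ ∧ ¬ IsSquare (θ : maximalRealSubfield L) ∧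
      ∀ (v : InfinitePlace (maximalRealSubfield L)) (hv : v.IsReal),
        embedding_of_isReal hv (θ : maximalRealSubfield L) < 0 := by
  obtain ⟨x, hx⟩ := IsCMField.exists_complexConj_ne L
  -- `α₀ = x - σ x` is purely imaginary and non-zero
  set α₀ : L := x - IsCMField.complexConj L x with hα₀
  have hc₀ : IsCMField.complexConj L α₀ = -α₀ := by
    rw [hα₀, map_sub, IsCMField.complexConj_apply_apply, neg_sub]
  have hα₀0 : α₀ ≠ 0 := by
    intro h
    rw [hα₀, sub_eq_zero] at h
    exact hx h.symm
  -- `α₀² = p / q` with `p, q ∈ 𝓞 L⁺`; take `α = q α₀`, `θ = p q`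
  set a : maximalRealSubfield L := ⟨α₀ ^ 2, sq_mem_maximalRealSubfield_of_complexConj_eq_neg hc₀⟩ with ha
  obtain ⟨p, q, hq, hpq⟩ := IsFractionRing.div_surjective (A := 𝓞 (maximalRealSubfield L)) a
  have hq0 : (algebraMap (𝓞 (maximalRealSubfield L)) (maximalRealSubfield L) q) ≠ 0 :=
    IsFractionRing.to_map_ne_zero_of_mem_nonZeroDivisors hq
  set α : L := algebraMap (maximalRealSubfield L) L (algebraMap (𝓞 (maximalRealSubfield L)) _ q) * α₀ with hαdef
  have hc : IsCMField.complexConj L α = -α := by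
    rw [hαdef, map_mul, AlgEquiv.commutes, hc₀, mul_neg]
  have hα0 : α ≠ 0 := mul_ne_zero ((map_ne_zero _).2 hq0) hα₀0
  have hsq : α ^ 2 = algebraMap (maximalRealSubfield L) L ((p * q : 𝓞 (maximalRealSubfield L)) : maximalRealSubfield L) := by
    have h1 : (α₀ ^ 2 : L) = algebraMap (maximalRealSubfield L) L a := rfl
    have h2 : (a : maximalRealSubfield L) * (algebraMap (𝓞 (maximalRealSubfield L)) _ q) ^ 2 =
        ((p * q : 𝓞 (maximalRealSubfield L)) : maximalRealSubfield L) := by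
      rw [← hpq, RingOfIntegers.coe_eq_algebraMap, map_mul]
      field_simp
    rw [hαdef, mul_pow, h1, ← map_pow, ← map_mul, mul_comm, h2]
  exact ⟨p * q, α, hα0, hc, hsq, not_isSquare_of_sq_eq hc hα0 hsq,
    fun v hv => embedding_lt_zero_of_sq_eq hc hα0 hsq v hv⟩

variable {L}

/-! ## Uniqueness up to squares -/

/-- Two purely imaginary elements, the first non-zero, differ by a factor from `L⁺`:
`β = r α`, `r = β / α ∈ L⁺`. [folklore] -/
theorem exists_eq_algebraMap_mul_of_complexConj_eq_neg {α β : L} (hα : IsCMField.complexConj L α = -α)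
    (hα0 : α ≠ 0) (hβ : IsCMField.complexConj L β = -β) :
    ∃ r : maximalRealSubfield L, β = algebraMap (maximalRealSubfield L) L r * α := by
  have hmem : β / α ∈ maximalRealSubfield L := by
    rw [← IsCMField.complexConj_eq_self_iff, map_div₀, hα, hβ, neg_div_neg_eq]
  refine ⟨⟨β / α, hmem⟩, ?_⟩
  change β = β / α * α
  exact (div_mul_cancel₀ β hα0).symm

/-- **The square class of `θ` is an invariant of `L/L⁺`.** If `α² = θ` and `β² = θ'` with `α, β ∈ L` purely
imaginary (`σ α = -α`, `σ β = -β`) and `α ≠ 0`, then `θ' = θ r²` for some `r ∈ L⁺`. [folklore] -/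
theorem exists_mul_sq_eq_of_sq_eq {α β : L} (hα : IsCMField.complexConj L α = -α) (hα0 : α ≠ 0)
    (hβ : IsCMField.complexConj L β = -β) {θ θ' : maximalRealSubfield L}
    (hθ : α ^ 2 = algebraMap (maximalRealSubfield L) L θ) (hθ' : β ^ 2 = algebraMap (maximalRealSubfield L) L θ') :
    ∃ r : maximalRealSubfield L, θ' = θ * r ^ 2 := by
  obtain ⟨r, hr⟩ := exists_eq_algebraMap_mul_of_complexConj_eq_neg hα hα0 hβ
  refine ⟨r, (algebraMap (maximalRealSubfield L) L).injective ?_⟩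
  rw [← hθ', hr, mul_pow, hθ, ← map_pow, ← map_mul, mul_comm]

end Literature.NumberTheory.NumberFields

end
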